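import Literature.AlgebraicGeometry.Modules.PullbackFrame
import Literature.AlgebraicGeometry.Modules.LineBundleOfCocycleClass
import Literature.AlgebraicGeometry.Motives.CartierDivisorLineBundleSectionsOn
import Literature.AlgebraicGeometry.Motives.CartierDivisorCocycle
import Literature.AlgebraicGeometry.Motives.FunctionFieldOver
import HarnessLib

/-!
# A trivialisation of the PULLED-BACK line bundle `p^* 𝒪_Y(D) ≅ 𝒪_X` is a local equation of `p^* D`
# (Görtz–Wedhorn I, (11.9) / Prop. 11.21 for `p^* D`: `𝒪_X(p^* D) ≅ 𝒪_X` iff `p^* D` is principal)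

Layer `Literature/AlgebraicGeometry/Motives`, namespace `Literature.AlgebraicGeometry.Motives.CartierDivisor` (dot notation on `D`).
THEOREMS ONLY (no definition, no named fact, no instance, no notation, no `sorry`).  The `p^*`-twin of ★
`Motives/CartierDivisorLineBundleIsoRatFn` (an iso `𝒪_Y(D) ≅ 𝒪_Y` is multiplication by a rational function `h` with `h / f_i`
units), stated directly for Mathlib's abstract inverse image `(Scheme.Modules.pullback p).obj (lineBundle D.toUnitCocycle)` of
the glued line bundle (★ `Modules/LineBundleOfCocycle`) along a dominant morphism `p : X → Y` of integral schemes — so that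
NO comparison isomorphism `p^* 𝒪_Y(D) ≅ 𝒪_X(p^* D)` is needed.

For a trivialisation `γ : p^* 𝒪_Y(D) ≅ 𝒪_X` and a point `z ∈ Y` with chart `U_z = U_{i(z)}` of `D = (U_i, f_i)` and local
generator `t_z` of `𝒪_Y(D)|_{U_z}` (★ `lineBundleGen`), put `u_z := γ(η_p t_z) ∈ Γ(X, p⁻¹ U_z)` (`η_p` = ★ `unitSection`, the
pulled-back section) and read it in `K(X)` (★ `RatFn.ofSection`).

* §1 (any morphism `p`, any unit cocycle `c`) **`exists_eq_smul_unitSection_lineBundleGen`** — over `W ≤ p⁻¹ U_z` every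
  section of `p^*(lineBundle c)` is a multiple of `η_p(t_z)|_W` (the pulled-back frame ★ `pullbackFrame` of the rank-one
  frame ★ `lineBundleFrame`, ★ `eq_sum_coord_smul`); hence **`isUnit_app_unitSection_lineBundleGen`** — `u_z` is a UNIT
  (`γ⁻¹(1) = b • η_p t_z` gives `1 = b u_z`).
* §2 (`X, Y` integral, `p` dominant, `c = D.toUnitCocycle`) **`ofSection_unitSection_lineBundleGen_mul_eq`** — chart
  independence `u_w · p^♯ f_{i(w)} = u_z · p^♯ f_{i(z)}` in `K(X)` (the glue relation `t_w = g_{zw} t_z`, ★ `lineBundleGen_eq_smul`,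
  with `g_{zw} = f_{i(z)}/f_{i(w)}`, ★ `ofSection_toUnitCocycle_g`, pulled back by `η_p` and read through `γ`);
  **`exists_localEquation_of_pullback_iso_unit`** — there is `H ∈ K(X)^×` with `u_z · p^♯ f_{i(z)} = H` for every `z`
  and `H / p^♯ f_j` a unit on `p⁻¹ U_j` (so `div H = p^* D`), equivalently `p^♯ f_j · H⁻¹` a unit there (the shape of ★
  `AbelianVariety.IsTrivializer`).

Cell `hodgecm-mathlib` (D-0151), F-DAG hand (h9-S) brick (W2-iii) «fibre identification `ē^Θ_n(P,Q)` = character pairing»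
(B-plan1 (g15) 04:01:37Z): with `p = [n]_B`, `D = D_Q` and `γ` a trivialisation of `[n]^* 𝒪_B(D_Q)`, `H⁻¹` is a trivializer
of `[n]^* D_Q` and ★ `RelativeSpec/DiscrepancyInvariantSection` says `t_P^♯ H = e_n(P, ·) H`.  Count-neutral; HC_CM is
proved only modulo the 7 printed citations until rung 0 closes — nothing here is about HC.

## References
* [GortzWedhorn2020] U. Görtz, T. Wedhorn, *Algebraic Geometry I*, 2nd ed. (2020), (7.1), (7.8) (inverse image), Section (11.9)
  (p. 301), Prop. 11.21 (p. 302), Rem. 11.16 (the cocycle `f_i/f_j` of `𝒪(D)`).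
* [Hartshorne1977] R. Hartshorne, *Algebraic Geometry*, GTM 52 (1977), II §5 (p. 110) (`f^*`), II §6 (Cartier divisors).
* [MumfordAV1970] D. Mumford, *Abelian Varieties* (1970), §20 (p. 184).
-/

set_option autoImplicit false

noncomputable section

-- `TopCat.Presheaf`/`Scheme.Modules` are not reducible (as in Mathlib's `AlgebraicGeometry/Modules`).
set_option backward.isDefEq.respectTransparency false

universe u

open CategoryTheory Limits AlgebraicGeometry TopologicalSpace Opposite
open Literature.AlgebraicGeometry.Modules

namespace Literature.AlgebraicGeometry.Motives.CartierDivisor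

open RatFn

/-! ## §1 Sections of `p^*(lineBundle c)` near a chart: multiples of the pulled-back generator -/

section AnyCocycle

variable {X Y : Scheme.{u}} (p : X ⟶ Y) (c : UnitCocycle Y)
  (γ : (Scheme.Modules.pullback p).obj (Modules.lineBundle c) ≅ SheafOfModules.unit X.ringCatSheaf)

/-- A section restricted along an endomorphism of an open is unchanged. [cite: Hartshorne1977, II §5 (p. 110)] -/
private theorem presheaf_map_self' (N : X.Modules) {W : X.Opens} (i : W ⟶ W) (x : Γ(N, W)) :
    N.presheaf.map i.op x = x := by
  rw [Subsingleton.elim i (𝟙 W), op_id, CategoryTheory.Functor.map_id]; rfl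

/-- **Every section of `p^*(lineBundle c)` over `W ≤ p⁻¹ U_z` is a multiple of the pulled-back generator `η_p(t_z)|_W`**
(basis expansion ★ `eq_sum_coord_smul` in the pulled-back frame ★ `pullbackFrame p (c.lineBundleFrame z)`, whose single
basis section is `η_p(t_z)`: ★ `basisSection_pullbackFrame`, ★ `basisSection_lineBundleFrame`).
[cite: Hartshorne1977, II §5 (p. 110)] [cite: GortzWedhorn2020, Section (7.8)] -/
theorem exists_eq_smul_unitSection_lineBundleGen (z : Y) {W : X.Opens} (k : W ⟶ p ⁻¹ᵁ c.U z)
    (t : Γ((Scheme.Modules.pullback p).obj (Modules.lineBundle c), W)) :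
    ∃ b : Γ(X, W), t = b • ((Scheme.Modules.pullback p).obj (Modules.lineBundle c)).presheaf.map k.op
      (unitSection p (Modules.lineBundle c) (c.U z) (c.lineBundleGen z (c.U z) le_rfl)) := by
  have h := eq_sum_coord_smul (pullbackFrame p (c.lineBundleFrame z)) k t
  rw [Fintype.sum_unique, basisSection_pullbackFrame, UnitCocycle.basisSection_lineBundleFrame] at h
  exact ⟨_, h⟩

/-- **`u_z := γ(η_p t_z)` is a unit function on `p⁻¹ U_z`** for every trivialisation `γ : p^*(lineBundle c) ≅ 𝒪_X`
(`γ⁻¹(1) = b • η_p t_z`, so `1 = b · u_z`). [cite: GortzWedhorn2020, Section (11.9) (p. 301)] [cite: Hartshorne1977, II §5 (p. 110)] -/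
theorem isUnit_app_unitSection_lineBundleGen (z : Y) :
    IsUnit (show Γ(X, p ⁻¹ᵁ c.U z) from γ.hom.app (p ⁻¹ᵁ c.U z)
      (unitSection p (Modules.lineBundle c) (c.U z) (c.lineBundleGen z (c.U z) le_rfl))) := by
  obtain ⟨b, hb⟩ := exists_eq_smul_unitSection_lineBundleGen p c z (𝟙 _) (γ.inv.app (p ⁻¹ᵁ c.U z) (1 : Γ(X, p ⁻¹ᵁ c.U z)))
  rw [presheaf_map_self'] at hb
  have h1 : (show Γ(X, p ⁻¹ᵁ c.U z) from γ.hom.app _ (γ.inv.app (p ⁻¹ᵁ c.U z) (1 : Γ(X, p ⁻¹ᵁ c.U z)))) = 1 := by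
    rw [← CategoryTheory.comp_apply, ← Scheme.Modules.Hom.comp_app, γ.inv_hom_id, Scheme.Modules.Hom.id_app]
    rfl
  rw [hb, Scheme.Modules.Hom.app_smul] at h1
  exact IsUnit.of_mul_eq_one_right _ h1

end AnyCocycle

/-! ## §2 The local equation `H` of `p^* D` attached to a trivialisation of `p^* 𝒪_Y(D)` -/

section Divisor

variable {X Y : Scheme.{u}} [IsIntegral X] [IsIntegral Y] (p : X ⟶ Y) [IsDominant p] (D : CartierDivisor Y)
  (γ : (Scheme.Modules.pullback p).obj (Modules.lineBundle D.toUnitCocycle) ≅ SheafOfModules.unit X.ringCatSheaf)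

omit [IsIntegral X] [IsDominant p] in
/-- Naturality of a morphism of modules with respect to restriction, on elements. [cite: GortzWedhorn2020, Section (7.1)] -/
private theorem app_presheaf_map'' {M N : X.Modules} (ψ : M ⟶ N) {U W : X.Opens} (i : U ⟶ W) (y : Γ(M, W)) :
    ψ.app U (M.presheaf.map i.op y) = N.presheaf.map i.op (ψ.app W y) :=
  ConcreteCategory.congr_hom (ψ.mapPresheaf.naturality i.op) y

/-- The generic point of `X` lies over every chart `U_z`. [cite: GortzWedhorn2020, Section (11.9) (p. 301)] -/
theorem genericPoint_mem_preimage_toUnitCocycle_U (z : Y) : genericPoint X ∈ p ⁻¹ᵁ D.toUnitCocycle.U z :=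
  genericPoint_mem_preimage p (genericPoint_mem_of_mem (D.toUnitCocycle.mem z))

/-- `u_z` read over a smaller open `p⁻¹ V`, `V ≤ U_z`: the rational function of `γ(η_p(t_z|_V))` is that of `u_z`
(★ `map_lineBundleGen`, ★ `unitSection_map`, naturality of `γ`, ★ `ofSection_map`). [cite: GortzWedhorn2020, Section (11.9) (p. 301)] -/
theorem ofSection_app_unitSection_lineBundleGen_of_le (z : Y) {V : Y.Opens} (hV : V ≤ D.toUnitCocycle.U z)
    (hV' : genericPoint X ∈ p ⁻¹ᵁ V) :
    ofSection hV' (show Γ(X, p ⁻¹ᵁ V) from γ.hom.app (p ⁻¹ᵁ V)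
        (unitSection p (Modules.lineBundle D.toUnitCocycle) V (D.toUnitCocycle.lineBundleGen z V hV))) =
      ofSection (D.genericPoint_mem_preimage_toUnitCocycle_U p z) (show Γ(X, p ⁻¹ᵁ D.toUnitCocycle.U z) from
        γ.hom.app (p ⁻¹ᵁ D.toUnitCocycle.U z) (unitSection p (Modules.lineBundle D.toUnitCocycle) (D.toUnitCocycle.U z)
          (D.toUnitCocycle.lineBundleGen z (D.toUnitCocycle.U z) le_rfl))) := by
  rw [← D.toUnitCocycle.map_lineBundleGen z le_rfl (homOfLE hV), unitSection_map, app_presheaf_map'']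
  exact ofSection_map _ hV' _

/-- **Chart independence `u_w · p^♯ f_{i(w)} = u_z · p^♯ f_{i(z)}` in `K(X)`**: over `V = U_z ∩ U_w` the generators satisfy
`t_w = g_{zw} t_z` with `g_{zw} = f_{i(z)} / f_{i(w)}` (★ `lineBundleGen_eq_smul`, ★ `ofSection_toUnitCocycle_g`); pull back by
`η_p` (★ `unitSection_smul`) and read through `γ`. [cite: GortzWedhorn2020, Section (11.9) (p. 301) and Rem. 11.16] -/
theorem ofSection_unitSection_lineBundleGen_mul_eq (z w : Y) :
    ofSection (D.genericPoint_mem_preimage_toUnitCocycle_U p w) (show Γ(X, p ⁻¹ᵁ D.toUnitCocycle.U w) from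
        γ.hom.app (p ⁻¹ᵁ D.toUnitCocycle.U w) (unitSection p (Modules.lineBundle D.toUnitCocycle) (D.toUnitCocycle.U w)
          (D.toUnitCocycle.lineBundleGen w (D.toUnitCocycle.U w) le_rfl))) *
        functionFieldMap p (D.f (D.chartIdx w)) =
      ofSection (D.genericPoint_mem_preimage_toUnitCocycle_U p z) (show Γ(X, p ⁻¹ᵁ D.toUnitCocycle.U z) from
        γ.hom.app (p ⁻¹ᵁ D.toUnitCocycle.U z) (unitSection p (Modules.lineBundle D.toUnitCocycle) (D.toUnitCocycle.U z)
          (D.toUnitCocycle.lineBundleGen z (D.toUnitCocycle.U z) le_rfl))) *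
        functionFieldMap p (D.f (D.chartIdx z)) := by
  -- work over `V := U_z ⊓ U_w`
  have hV : genericPoint Y ∈ D.toUnitCocycle.U z ⊓ D.toUnitCocycle.U w :=
    ⟨genericPoint_mem_of_mem (D.toUnitCocycle.mem z), genericPoint_mem_of_mem (D.toUnitCocycle.mem w)⟩
  have hV' : genericPoint X ∈ p ⁻¹ᵁ (D.toUnitCocycle.U z ⊓ D.toUnitCocycle.U w) := genericPoint_mem_preimage p hV
  rw [← D.ofSection_app_unitSection_lineBundleGen_of_le p γ w inf_le_right hV',
    ← D.ofSection_app_unitSection_lineBundleGen_of_le p γ z inf_le_left hV',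
    D.toUnitCocycle.lineBundleGen_eq_smul z w _ inf_le_left inf_le_right, unitSection_smul, Scheme.Modules.Hom.app_smul]
  change ofSection hV' (@HMul.hMul Γ(X, p ⁻¹ᵁ (D.toUnitCocycle.U z ⊓ D.toUnitCocycle.U w)) _ _ instHMul
    (p.app _ (D.toUnitCocycle.g z w _ inf_le_left inf_le_right)) _) * _ = _
  rw [ofSection_mul', ← functionFieldMap_ofSection p hV, D.ofSection_toUnitCocycle_g z w inf_le_left inf_le_right hV,
    map_div₀]
  have hz : functionFieldMap p (D.f (D.chartIdx z)) ≠ 0 := (map_ne_zero _).mpr (D.f_ne_zero _)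
  have hw : functionFieldMap p (D.f (D.chartIdx w)) ≠ 0 := (map_ne_zero _).mpr (D.f_ne_zero _)
  field_simp

/-- `u_z ≠ 0` in `K(X)`. [cite: GortzWedhorn2020, Section (11.9) (p. 301)] -/
theorem ofSection_unitSection_lineBundleGen_ne_zero (z : Y) :
    ofSection (D.genericPoint_mem_preimage_toUnitCocycle_U p z) (show Γ(X, p ⁻¹ᵁ D.toUnitCocycle.U z) from
        γ.hom.app (p ⁻¹ᵁ D.toUnitCocycle.U z) (unitSection p (Modules.lineBundle D.toUnitCocycle) (D.toUnitCocycle.U z)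
          (D.toUnitCocycle.lineBundleGen z (D.toUnitCocycle.U z) le_rfl))) ≠ 0 := by
  obtain ⟨x, hx⟩ : ∃ x : X, x ∈ p ⁻¹ᵁ D.toUnitCocycle.U z := ⟨genericPoint X, D.genericPoint_mem_preimage_toUnitCocycle_U p z⟩
  exact (isUnitAt_ofSection_of_isUnit (isUnit_app_unitSection_lineBundleGen p D.toUnitCocycle γ z) hx).ne_zero

/-- **THE LOCAL EQUATION OF `p^* D` ATTACHED TO A TRIVIALISATION `γ : p^* 𝒪_Y(D) ≅ 𝒪_X`**: there is `H ∈ K(X)^×` with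
`H = u_z · p^♯ f_{i(z)}` for every `z ∈ Y` (`u_z = γ(η_p t_z)` read in `K(X)`), and `H / p^♯ f_j` is a unit at every point of
`p⁻¹ U_j` — i.e. `div(H) = p^* D`; Görtz–Wedhorn I Prop. 11.21 for `p^* D` (`𝒪_X(p^*D) ≅ p^* 𝒪_Y(D)` trivial ⇔ `p^* D`
principal), proved without naming `𝒪_X(p^* D)`. [cite: GortzWedhorn2020, Prop. 11.21 (p. 302) and Section (11.9) (p. 301)] -/
theorem exists_localEquation_of_pullback_iso_unit :
    ∃ H : X.functionField, H ≠ 0 ∧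
      (∀ z : Y, ofSection (D.genericPoint_mem_preimage_toUnitCocycle_U p z) (show Γ(X, p ⁻¹ᵁ D.toUnitCocycle.U z) from
          γ.hom.app (p ⁻¹ᵁ D.toUnitCocycle.U z) (unitSection p (Modules.lineBundle D.toUnitCocycle) (D.toUnitCocycle.U z)
            (D.toUnitCocycle.lineBundleGen z (D.toUnitCocycle.U z) le_rfl))) *
          functionFieldMap p (D.f (D.chartIdx z)) = H) ∧
      (∀ (j : D.ι) (x : X), p x ∈ D.U j → IsUnitAt x (H / functionFieldMap p (D.f j))) ∧
      ∀ (j : D.ι) (x : X), p x ∈ D.U j → IsUnitAt x (functionFieldMap p (D.f j) * H⁻¹) := by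
  have hunit : ∀ (j : D.ι) (x : X), p x ∈ D.U j →
      IsUnitAt x (ofSection (D.genericPoint_mem_preimage_toUnitCocycle_U p (p x))
        (show Γ(X, p ⁻¹ᵁ D.toUnitCocycle.U (p x)) from
          γ.hom.app (p ⁻¹ᵁ D.toUnitCocycle.U (p x)) (unitSection p (Modules.lineBundle D.toUnitCocycle)
            (D.toUnitCocycle.U (p x)) (D.toUnitCocycle.lineBundleGen (p x) (D.toUnitCocycle.U (p x)) le_rfl))) *
          functionFieldMap p (D.f (D.chartIdx (p x))) / functionFieldMap p (D.f j)) := by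
    intro j x hx
    have hxz : x ∈ p ⁻¹ᵁ D.toUnitCocycle.U (p x) := D.toUnitCocycle.mem (p x)
    rw [mul_div_assoc, ← map_div₀]
    exact (isUnitAt_ofSection_of_isUnit (isUnit_app_unitSection_lineBundleGen p D.toUnitCocycle γ (p x)) hxz).mul
      (D.isUnitAt_div (D.chartIdx (p x)) j (p x) (D.mem_U_chartIdx (p x)) hx).functionFieldMap
  refine ⟨ofSection (D.genericPoint_mem_preimage_toUnitCocycle_U p (genericPoint Y))
      (show Γ(X, p ⁻¹ᵁ D.toUnitCocycle.U (genericPoint Y)) from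
        γ.hom.app (p ⁻¹ᵁ D.toUnitCocycle.U (genericPoint Y)) (unitSection p (Modules.lineBundle D.toUnitCocycle)
          (D.toUnitCocycle.U (genericPoint Y))
          (D.toUnitCocycle.lineBundleGen (genericPoint Y) (D.toUnitCocycle.U (genericPoint Y)) le_rfl))) *
      functionFieldMap p (D.f (D.chartIdx (genericPoint Y))), ?_, fun z => ?_, fun j x hx => ?_, fun j x hx => ?_⟩
  · exact mul_ne_zero (D.ofSection_unitSection_lineBundleGen_ne_zero p γ _) ((map_ne_zero _).mpr (D.f_ne_zero _))
  · exact D.ofSection_unitSection_lineBundleGen_mul_eq p γ (genericPoint Y) z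
  · rw [D.ofSection_unitSection_lineBundleGen_mul_eq p γ (p x) (genericPoint Y)]
    exact hunit j x hx
  · rw [D.ofSection_unitSection_lineBundleGen_mul_eq p γ (p x) (genericPoint Y), ← div_eq_mul_inv, ← inv_div]
    exact (hunit j x hx).inv

end Divisor

end Literature.AlgebraicGeometry.Motives.CartierDivisor

end
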